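import Summits.BirchSwinnertonDyer.BirchSwinnertonDyer.Theorems.ByReductionTypeAtTwoOrdKatoIntDefs
import Summits.BirchSwinnertonDyer.Rank1Residual.X5.TwoAdicTargetsEndStateClosed
import HarnessLib

/-!
# Route ByReductionTypeAtTwo, crux `OrdKatoHalfAtTwoIso` (stmt-BirchSwinnertonDyer-19573), stub
# `stub_surj`: the binder road at RESERVE-REFEREED tier — W_K2 Theorem B VERBATIM (Kato's divisibility
# at a good ordinary `2` for 2-adically surjective curves, normalised by the least real period, i.e.
# with the archimedean factor `c_∞ = #π₀(E(ℝ))`), its kernel relations to the GEN-8 binder and to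
# MEMO-6, and its per-class doors to `BSD(E,2)` on BOTH signs of `Δ`

Seat `bsd-2adic-ord` GEN 9 (HOME `run/shared/lean/pub/bsd-2adic/`; MEMO-5 ADDENDUM-1 §D.2, MEMO-6 §7).
Theses-free module, pattern of `ByReductionTypeAtTwoOrdKatoIntDefs.lean` (GEN 8, p464176): TWO
`@[conjecture]` constants + PROVED bookkeeping; nothing asserted; no Literature fact minted.

WHY THIS FILE. GEN 8 displayed ONE binder `KatoIntAtGoodOrdSurjectiveTwo` = the SHARP Kato half at
every 2-adically surjective good-ordinary curve; at `Δ > 0` that is the cell's MEMO-6 (Theorem C,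
referee pending), at `Δ < 0` the reserve wall W_K2 Theorem B (cross-family review UPHELD 2026-08-07).
Per class, however, `BSD(E,2)` does NOT need the sharp form at `Δ > 0`: W_K2 Theorem B alone gives
Kato's divisibility with slack `ord₂ c_∞ ≤ 1`, and the X5 END-STATE consumer
`O1.bsdp_two_goodOrd_of_kato_le_one_of_facts` (slack `k ≤ 1` + the parity certificate
`ShaAnTwoAdicValEven` + Cassels–Tate) closes `BSD(E,2)`. So the two tiers are separated here:

* `KatoReserveWK2AtGoodOrdSurjectiveTwo` — [crux, RESERVE-REFEREED] W_K2 Thm. B verbatim in tree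
  currency: `char_Λ X ∋ g` with `ι g = c_∞(W)·ϖ·L₂(f, α)`, `c_∞(W) = (W.baseChange ℝ).numRealComponents`;
* `KatoIntAtGoodOrdSurjectivePosTwo` — [crux, CELL-MEMO] MEMO-6 Thm. C: the sharp form at `Δ > 0`;
* PROVED relations: GEN-8 binder ⟹ reserve binder; reserve binder ⟹ the item AT `W` when `Δ_W < 0`;
  reserve binder ∧ Pos-memo binder ⟺ GEN-8 binder (`katoIntAtGoodOrdSurjectiveTwo_iff_reserve_and_pos`);
  reserve binder + Kato 17.4 (1) at `2` (torsion) + Abbes–Ullmo (period unit) ⟹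
  `O1.KatoDivisibilityAtTwoUpTo W 1 f` at every 2-adically surjective good-ordinary `W`;
* PROVED doors: `Δ < 0` — reserve + PRINT {`hEC`, `hmod`, `hGZK`, `h17`} + CERT {`hlow`} ⇒ `BSDp W 2`;
  any sign — reserve + PRINT {`hAU`, `hCT`, `hGr`, `hmod`, `hGZK`, `h17`} + CERT {`heven`, `hlow`} ⇒
  `BSDp W 2`, plus the Dokchitser–Dokchitser habitat variants (image decided from kernel data).

Tier bookkeeping only: per the cell's bar, rows through a RESERVE binder are NO-OFFER until the
planner/director rules otherwise (precedent: -mult's W_K2-transported `KatoIntAtNonsplitSurjectiveTwo`).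
PARTITION: X5@2 good-ord (B1·O1; 611 classes; habitat = the 436 E[2]-irreducible 2-adically-surjective
classes, 328 `Δ < 0` + 108 `Δ > 0`) × p = 2 — types-the-object-of; closes none; nothing booked.
-/

set_option autoImplicit false
set_option linter.dupNamespace false

noncomputable section

open scoped Classical MatrixGroups ModularForm

open CongruenceSubgroup WeierstrassCurve Literature.NumberTheory.EllipticCurves
  Literature.NumberTheory.EllipticCurves.ModularForms
  Literature.NumberTheory.EllipticCurves.Rank1Residual
  Literature.NumberTheory.EllipticCurves.Rank1Residual.Typed
  Literature.NumberTheory.EllipticCurves.SkinnerUrban2014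
  Summit.BirchSwinnertonDyer.Rank1Residual.X5

namespace Summit.BirchSwinnertonDyer.BirchSwinnertonDyer.Theorems.OrdKatoIntAtTwo

/-- [crux, RESERVE-REFEREED] **W_K2 Theorem B in tree currency — Kato's divisibility at a good
ordinary `2` for 2-adically surjective curves, LEAST-REAL-PERIOD normalisation.** For every globally
minimal elliptic `W/ℚ`, good ordinary at `2`, with `ρ_{W,2^∞}(G_ℚ) = GL₂(ℤ₂)`: for every cyclotomic
datum `(κ, γ)`, the newform `f` of level `N_W`, every `ϖ ∈ ℚ` with `ϖ·Ω_W = Ω⁺_f` and every Selmer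
dual datum `D`, SOME `g ∈ char_Λ X` has `ι g = c_∞(W)·ϖ·L₂(f, α)`, where
`c_∞(W) = #π₀(W(ℝ)) = (W.baseChange ℝ).numRealComponents ∈ {1, 2}` and `Ω_W = W.realPeriodRat = c_∞(W)·Ω⁺_W`
(`realPeriod_eq_numRealComponents_mul_minRealPeriod`), so that `c_∞(W)·ϖ·L₂(f, α)` is the 2-adic
`L`-function normalised by the least positive real period `Ω⁺_W` — EXACTLY the `L₂(E,T)` of the reserve
paper. Source: reserve summit `bsd-w-kato-divisibility-at-2`, `free/w2/paper/paper.tex` v1e Theorem B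
(Rubin [Ru00] II.3.8(ii) over `ℚ_∞` + Kato [Ka04] §§12–17 parity inventory), review UPHELD 2026-08-07
(cross-family); independently re-derived with Kato's [KK4] engine in the cell's MEMO-5 (+ ADDENDUM-1).
NOT in print at `p = 2`. Nothing asserted.
[cite: Kato2004Asterisque, Thm. 12.4–12.6 (pp. 221–223), Thm. 17.4 (p. 273), 17.13 (pp. 279–280) (shape; the p = 2 integral clause is NOT in print)]
[cite: Rubin2000, Thm. II.3.8 (ii) (shape of the engine)] -/
@[conjecture] def KatoReserveWK2AtGoodOrdSurjectiveTwo : Prop :=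
  ∀ (W : WeierstrassCurve ℚ) [W.IsElliptic] [W.IsGloballyMinimal],
    GoodOrd W 2 → O1.TwoAdicSurjective W →
    ∀ (κ : ZpExtension ℚ 2) (γ : Field.absoluteGaloisGroup ℚ),
      κ.IsCyclotomic → κ.IsTopGenerator γ → IsCyclotomicVariable 2 γ →
    ∀ [NeZero (W.conductorNorm ℤ)] (f : CuspForm (Gamma0 (W.conductorNorm ℤ)) 2),
      IsNewformOf W f → ∀ (ϖ : ℚ), (ϖ : ℝ) * W.realPeriodRat = plusPeriod f →
    ∀ (D : W.SelmerDualData κ γ), ∃ g ∈ D.charIdeal,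
      iwasawaToPowerSeries 2 g =
        PowerSeries.C ((((W.baseChange ℝ).numRealComponents : ℕ) : ℚ_[2]) * (ϖ : ℚ_[2])) *
          padicLFunction f (unitRoot W 2 : ℚ_[2])

/-- [crux, CELL-MEMO] **The cell's MEMO-6 (Theorem C = W_K2♯) as a displayed binder: the SHARP Kato
half at a good ordinary `2` for 2-adically surjective curves with `Δ > 0`** (BSD-period normalisation,
no archimedean factor): for every globally minimal elliptic `W/ℚ`, good ordinary at `2`, with
`ρ_{W,2^∞}` onto and `0 < Δ_W`: `X5.O1.MainConjectureLowerDivisibilityAtTwoOrd W`. Source: cell memo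
`HOME/bsd-2adic-ord-MEMO-6.md` @d09c0d61d7ec487d (lemmas L1–L4 on the reserve blueprint sharp.tex;
referee C checkpoints RC-C-1..12 pending). NOT in print; NOT reserve-refereed. Nothing asserted.
[cite: Kato2004Asterisque, Thm. 13.6 (Ash–Stevens/Manin), Thm. 6.6, 9.7, 12.4 (1)(2), 12.5 (1), 13.5 (2) (inputs of L1–L2; shape)]
[cite: Rubin2000, Def. II.1.1 and Thm. II.3.8 (ii) (inputs of L3–L4; shape)] -/
@[conjecture] def KatoIntAtGoodOrdSurjectivePosTwo : Prop :=
  ∀ (W : WeierstrassCurve ℚ) [W.IsElliptic] [W.IsGloballyMinimal],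
    GoodOrd W 2 → O1.TwoAdicSurjective W → 0 < W.Δ → O1.MainConjectureLowerDivisibilityAtTwoOrd W

/-- `KatoReserveWK2AtGoodOrdSurjectiveTwo` unfolds to its displayed body. [folklore] -/
theorem katoReserveWK2AtGoodOrdSurjectiveTwo_iff : KatoReserveWK2AtGoodOrdSurjectiveTwo ↔
    ∀ (W : WeierstrassCurve ℚ) [W.IsElliptic] [W.IsGloballyMinimal],
      GoodOrd W 2 → O1.TwoAdicSurjective W →
      ∀ (κ : ZpExtension ℚ 2) (γ : Field.absoluteGaloisGroup ℚ),
        κ.IsCyclotomic → κ.IsTopGenerator γ → IsCyclotomicVariable 2 γ →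
      ∀ [NeZero (W.conductorNorm ℤ)] (f : CuspForm (Gamma0 (W.conductorNorm ℤ)) 2),
        IsNewformOf W f → ∀ (ϖ : ℚ), (ϖ : ℝ) * W.realPeriodRat = plusPeriod f →
      ∀ (D : W.SelmerDualData κ γ), ∃ g ∈ D.charIdeal,
        iwasawaToPowerSeries 2 g =
          PowerSeries.C ((((W.baseChange ℝ).numRealComponents : ℕ) : ℚ_[2]) * (ϖ : ℚ_[2])) *
            padicLFunction f (unitRoot W 2 : ℚ_[2]) :=
  Iff.rfl

/-- `KatoIntAtGoodOrdSurjectivePosTwo` unfolds to its displayed body. [folklore] -/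
theorem katoIntAtGoodOrdSurjectivePosTwo_iff : KatoIntAtGoodOrdSurjectivePosTwo ↔
    ∀ (W : WeierstrassCurve ℚ) [W.IsElliptic] [W.IsGloballyMinimal],
      GoodOrd W 2 → O1.TwoAdicSurjective W → 0 < W.Δ →
        O1.MainConjectureLowerDivisibilityAtTwoOrd W :=
  Iff.rfl

variable (W : WeierstrassCurve ℚ) [W.IsElliptic] [W.IsGloballyMinimal]

/-! ## §1 The archimedean factor `c_∞(W)` from the sign of `Δ_W` -/

omit [W.IsElliptic] [W.IsGloballyMinimal] in
/-- `Δ_W < 0` (one real component): `c_∞(W) = 1`. [cite: CremonaAlgorithms1997, §3.7] -/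
theorem numRealComponents_baseChange_eq_one_of_Δ_neg (hΔ : W.Δ < 0) :
    (W.baseChange ℝ).numRealComponents = 1 := by
  apply numRealComponents_of_Δ_nonpos
  have h : (W.baseChange ℝ).Δ = ((W.Δ : ℚ) : ℝ) := by
    simp [WeierstrassCurve.baseChange, WeierstrassCurve.map_Δ]
  rw [h]
  exact_mod_cast hΔ.le

omit [W.IsElliptic] [W.IsGloballyMinimal] in
/-- `Δ_W > 0` (two real components): `c_∞(W) = 2`. [cite: CremonaAlgorithms1997, §3.7] -/
theorem numRealComponents_baseChange_eq_two_of_Δ_pos (hΔ : 0 < W.Δ) :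
    (W.baseChange ℝ).numRealComponents = 2 := by
  apply numRealComponents_of_Δ_pos
  have h : (W.baseChange ℝ).Δ = ((W.Δ : ℚ) : ℝ) := by
    simp [WeierstrassCurve.baseChange, WeierstrassCurve.map_Δ]
  rw [h]
  exact_mod_cast hΔ

omit [W.IsElliptic] [W.IsGloballyMinimal] in
/-- `c_∞(W) = 2ⁿ` with `n ≤ 1` (`n = 0` for `Δ ≤ 0`, `n = 1` for `Δ > 0`). [cite: CremonaAlgorithms1997, §3.7] -/
theorem numRealComponents_baseChange_eq_two_pow :
    ∃ n : ℕ, n ≤ 1 ∧ (W.baseChange ℝ).numRealComponents = 2 ^ n := by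
  unfold numRealComponents
  split_ifs
  · exact ⟨1, le_rfl, by norm_num⟩
  · exact ⟨0, zero_le_one, by norm_num⟩

/-! ## §2 Kernel relations between the three binders -/

/-- Bookkeeping in `Λ = ℤ₂⟦T⟧ ↪ ℚ₂⟦T⟧`: `ι (C a · g) = C ↑a · ι g`. [cite: MazurTateTeitelbaum1986Invent, §I.12 (Λ ↪ ℚ_p⟦T⟧)] -/
theorem iwasawaToPowerSeries_C_mul (a : ℤ_[2]) (g : IwasawaAlgebra 2) :
    iwasawaToPowerSeries 2 (PowerSeries.C a * g) =
      PowerSeries.C (a : ℚ_[2]) * iwasawaToPowerSeries 2 g := by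
  rw [map_mul]
  congr 1
  rw [show iwasawaToPowerSeries 2 (PowerSeries.C a) =
      PowerSeries.map (PadicInt.Coe.ringHom (p := 2)) (PowerSeries.C a) from rfl, PowerSeries.map_C]
  rfl

/-- **SHARP ⟹ RESERVE.** The GEN-8 binder (sharp Kato half at every 2-adically surjective good-ordinary
curve) implies W_K2 Theorem B in tree currency (multiply the sharp generator by `c_∞ ∈ {1, 2} ⊂ Λ`).
[folklore] -/
theorem katoReserveWK2_of_katoInt (h : KatoIntAtGoodOrdSurjectiveTwo) :
    KatoReserveWK2AtGoodOrdSurjectiveTwo := by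
  intro W _ _ hgo him κ γ hκ hγ hγ' _ f hf ϖ hϖ D
  obtain ⟨g, hg, hι⟩ := h W hgo him κ γ hκ hγ hγ' (show IsOrdinaryAt W 2 from hgo) f hf ϖ hϖ D
  refine ⟨PowerSeries.C (((W.baseChange ℝ).numRealComponents : ℕ) : ℤ_[2]) * g,
    D.charIdeal.mul_mem_left _ hg, ?_⟩
  rw [iwasawaToPowerSeries_C_mul, hι, ← mul_assoc, ← map_mul]
  norm_cast

/-- **RESERVE ⟹ the item AT `W` when `Δ_W < 0`** (`c_∞ = 1`: W_K2 Theorem B IS the sharp Kato half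
there; MEMO-5 Cor. B1 — the 328 `Δ < 0` classes of CENSUS-V4-2SURJ). [folklore] -/
theorem mainConjectureLowerDivisibilityAtTwoOrd_of_katoReserveWK2_of_Δ_neg
    (h : KatoReserveWK2AtGoodOrdSurjectiveTwo) (hgo : GoodOrd W 2) (him : O1.TwoAdicSurjective W)
    (hΔ : W.Δ < 0) : O1.MainConjectureLowerDivisibilityAtTwoOrd W := by
  intro κ γ hκ hγ hγ' _ _ f hf ϖ hϖ D
  obtain ⟨g, hg, hι⟩ := h W hgo him κ γ hκ hγ hγ' f hf ϖ hϖ D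
  refine ⟨g, hg, ?_⟩
  rw [hι, numRealComponents_baseChange_eq_one_of_Δ_neg W hΔ]
  simp

/-- **RESERVE ∧ POS-MEMO ⟹ SHARP**: W_K2 Theorem B (for `Δ < 0`) and MEMO-6 Theorem C (for `Δ > 0`)
together give the GEN-8 binder (`Δ_W ≠ 0` for an elliptic curve). [folklore] -/
theorem katoIntAtGoodOrdSurjectiveTwo_of_reserve_of_pos (h : KatoReserveWK2AtGoodOrdSurjectiveTwo)
    (hpos : KatoIntAtGoodOrdSurjectivePosTwo) : KatoIntAtGoodOrdSurjectiveTwo := by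
  intro W _ _ hgo him
  rcases lt_or_gt_of_ne W.isUnit_Δ.ne_zero with hΔ | hΔ
  · exact mainConjectureLowerDivisibilityAtTwoOrd_of_katoReserveWK2_of_Δ_neg W h hgo him hΔ
  · exact hpos W hgo him hΔ

/-- **SHARP ⟹ POS-MEMO** (restriction). [folklore] -/
theorem katoIntAtGoodOrdSurjectivePosTwo_of_katoInt (h : KatoIntAtGoodOrdSurjectiveTwo) :
    KatoIntAtGoodOrdSurjectivePosTwo :=
  fun W _ _ hgo him _ => h W hgo him

/-- **The tier decomposition of the GEN-8 binder**: SHARP ⟺ RESERVE ∧ POS-MEMO. [folklore] -/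
theorem katoIntAtGoodOrdSurjectiveTwo_iff_reserve_and_pos :
    KatoIntAtGoodOrdSurjectiveTwo ↔
      KatoReserveWK2AtGoodOrdSurjectiveTwo ∧ KatoIntAtGoodOrdSurjectivePosTwo :=
  ⟨fun h => ⟨katoReserveWK2_of_katoInt h, katoIntAtGoodOrdSurjectivePosTwo_of_katoInt h⟩,
    fun h => katoIntAtGoodOrdSurjectiveTwo_of_reserve_of_pos h.1 h.2⟩

/-! ## §3 RESERVE ⟹ the X5 END-STATE target `KatoDivisibilityAtTwoUpTo W 1 f` -/

/-- **RESERVE + Kato 17.4 (1) at `2` + Abbes–Ullmo ⟹ `O1.KatoDivisibilityAtTwoUpTo W 1 f`** at every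
globally minimal good-ordinary `W` (any sign of `Δ`): W_K2's generator has `ι g = c_∞·ϖ·L₂`, `c_∞ = 2ⁿ`
with `n ≤ 1` (§1), and `ϖ` is a `2`-adic unit by `realPeriodRat_eq_unit_mul_plusPeriod_two_of_abbesUllmo`
(Abbes–Ullmo 1996 Thm. A for `2 ∤ N` + Greenberg–Vatsal Rem. 3.4; `E[2]` irreducible on the big-image
locus), so `ι (u·g) = 2ⁿ·L₂` with `u = ϖ⁻¹ ∈ ℤ₂^× ⊂ Λ`; torsion of `X` is Kato 17.4 (1) at `2` (`h17`).
[cite: Kato2004Asterisque, Thm. 17.4 (1) (p. 273)] [cite: AbbesUllmo1996, Thm. A]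
[cite: GreenbergVatsal2000, §3 Rem. 3.4] -/
theorem katoDivisibilityAtTwoUpTo_one_of_katoReserveWK2 (h : KatoReserveWK2AtGoodOrdSurjectiveTwo)
    (hAU : abbesUllmo_not_dvd_maninConstant_of_not_dvd_level)
    (h17 : ∀ [NeZero (W.conductorNorm ℤ)] (f : CuspForm (Gamma0 (W.conductorNorm ℤ)) 2),
      kato_divisibility_allPrimes W 2 (f := f))
    (hgo : GoodOrd W 2) [NeZero (W.conductorNorm ℤ)] (f : CuspForm (Gamma0 (W.conductorNorm ℤ)) 2) :
    O1.KatoDivisibilityAtTwoUpTo W 1 f := by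
  intro κ γ hκ hγ hγ' hord hf him D
  refine ⟨(h17 f κ γ hκ hγ hγ' hord hf D).1, ?_⟩
  -- the period unit `Ω_W = u · Ω⁺_f`, `‖u‖₂ = 1`
  obtain ⟨u, hu, hΩ⟩ := realPeriodRat_eq_unit_mul_plusPeriod_two_of_abbesUllmo hAU W hord.1
    (O1.irr_two_of_twoAdicSurjective W him) f hf
  have hu0 : u ≠ 0 := by
    rintro rfl
    rw [Rat.cast_zero, zero_mul] at hΩ
    exact W.realPeriodRat_pos_holds.ne' hΩ
  -- `ϖ := u⁻¹` is a rational with `ϖ · Ω_W = Ω⁺_f`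
  have hϖ : ((u⁻¹ : ℚ) : ℝ) * W.realPeriodRat = plusPeriod f := by
    rw [hΩ, Rat.cast_inv, ← mul_assoc, inv_mul_cancel₀ (by exact_mod_cast hu0), one_mul]
  obtain ⟨g, hg, hι⟩ := h W hgo him κ γ hκ hγ hγ' f hf u⁻¹ hϖ D
  obtain ⟨n, hn, hc⟩ := numRealComponents_baseChange_eq_two_pow W
  -- `u` as a `2`-adic integer (a unit)
  obtain ⟨uZ, huZ⟩ : ∃ z : ℤ_[2], (z : ℚ_[2]) = (u : ℚ_[2]) := ⟨⟨(u : ℚ_[2]), hu.le⟩, rfl⟩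
  refine ⟨n, PowerSeries.C uZ * g, hn, D.charIdeal.mul_mem_left _ hg, ?_⟩
  rw [iwasawaToPowerSeries_C_mul, hι, ← mul_assoc, ← map_mul, hc, huZ]
  congr 2
  have huQ : (u : ℚ_[2]) ≠ 0 := by exact_mod_cast hu0
  push_cast
  field_simp

/-! ## §4 Per-class doors at RESERVE tier -/

/-- **`Δ < 0` door (sharp; no parity certificate, no Cassels–Tate, no Abbes–Ullmo)**: RESERVE binder +
PRINT {Greenberg Thm. 4.1 at `2` (`hEC`, `δ = 0`), modularity (`hmod`), GZK (`hGZK`), Kato 17.4 (1)(2)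
at `2` (`h17`)} + ONE descent certificate (`hlow : MissingLowerBoundAt W 2`) ⇒ `BSD(E,2)` on a rank-`0`
good-ordinary 2-adically surjective curve with `Δ < 0` — W_K2 Theorem B is the item there.
[cite: GreenbergLNM1716, Thm. 4.1 (p. 102)] [cite: Kato2004Asterisque, Thm. 17.4 (1) (p. 273)]
[cite: Miller2011LMS, Def. 1.1 and §1] -/
theorem bsdp_two_of_katoReserveWK2_of_Δ_neg_of_missingLowerBoundAt
    (h : KatoReserveWK2AtGoodOrdSurjectiveTwo)
    (hEC : O1.TwoAdicEulerCharRankZero W 0) (hmod : nonempty_modularParametrizationData)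
    (hGZK : rank_eq_analyticRank_of_analyticRank_le_one)
    (h17 : ∀ [NeZero (W.conductorNorm ℤ)] (f : CuspForm (Gamma0 (W.conductorNorm ℤ)) 2),
      kato_divisibility_allPrimes W 2 (f := f))
    (hr : W.analyticRank = 0) (hgo : GoodOrd W 2) (him : O1.TwoAdicSurjective W) (hΔ : W.Δ < 0)
    (hlow : MissingLowerBoundAt W 2) : BSDp W 2 :=
  bsdp_of_missingPPartAt W 2 hGZK (by rw [hr]; exact zero_le_one)
    (missingPPartAt_of_lower_of_upper W 2 hlow
      (O1.missingUpperBoundAt_two_of_mainConjectureLowerDivisibilityAtTwoOrd_of_kato W hEC hmod hGZK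
        h17 hr hgo (mainConjectureLowerDivisibilityAtTwoOrd_of_katoReserveWK2_of_Δ_neg W h hgo him hΔ)))

/-- **Any-sign door (slack one)**: RESERVE binder + PRINT {Abbes–Ullmo Thm. A (`hAU`), Cassels–Tate
(`hCT`), Greenberg Thm. 4.1 any prime (`hGr`), modularity, GZK, Kato 17.4 (1) at `2` (`h17`)} +
CERTIFICATES {`heven : ShaAnTwoAdicValEven W` (`ord₂ #Ш_an` even, rank-`0` `L`-value certificate),
`hlow : MissingLowerBoundAt W 2` (descent)} ⇒ `BSD(E,2)` on a non-CM rank-`0` good-ordinary 2-adically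
surjective curve — through the X5 END-STATE consumer `O1.bsdp_two_goodOrd_of_kato_le_one_of_facts`
at `k = 1`. This is the road of MEMO-5 ADDENDUM-1 §D.2 on ALL 436 binder-habitat classes at
reserve-refereed tier (both signs of `Δ`). [cite: AbbesUllmo1996, Thm. A]
[cite: GreenbergLNM1716, Thm. 4.1 (p. 102)] [cite: SilvermanAEC2009, Thm. X.4.14 (Cassels–Tate ⇒ #Ш square)]
[cite: Miller2011LMS, Def. 1.1 and §1] -/
theorem bsdp_two_of_katoReserveWK2_of_facts (h : KatoReserveWK2AtGoodOrdSurjectiveTwo)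
    (hAU : abbesUllmo_not_dvd_maninConstant_of_not_dvd_level)
    (hCT : exists_casselsTate_pairing (K := ℚ))
    (hGr : Greenberg1999.thm41_charValue_rankZero_anyPrime)
    (hmod : nonempty_modularParametrizationData)
    (hGZK : rank_eq_analyticRank_of_analyticRank_le_one)
    (h17 : ∀ [NeZero (W.conductorNorm ℤ)] (f : CuspForm (Gamma0 (W.conductorNorm ℤ)) 2),
      kato_divisibility_allPrimes W 2 (f := f))
    (hcm : ¬ W.HasCM) (hr : W.analyticRank = 0) (hgo : GoodOrd W 2) (him : O1.TwoAdicSurjective W)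
    (heven : O1.ShaAnTwoAdicValEven W) (hlow : MissingLowerBoundAt W 2) : BSDp W 2 :=
  O1.bsdp_two_goodOrd_of_kato_le_one_of_facts W hAU hCT hGr hmod hGZK 1 le_rfl
    (fun f => katoDivisibilityAtTwoUpTo_one_of_katoReserveWK2 W h hAU h17 hgo f)
    hcm hr hgo him heven hlow

/-- **`Δ < 0` door, habitat from Dokchitser–Dokchitser data** (all displayed inputs = the RESERVE
binder + PRINT facts by name + decidable per-curve data + one descent certificate).
[cite: DokchitserDokchitserMathZ2012, Theorem (p. 961)] [cite: Miller2011LMS, Def. 1.1 and §1] -/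
theorem bsdp_two_of_katoReserveWK2_of_dokchitser_of_Δ_neg_of_missingLowerBoundAt
    (h : KatoReserveWK2AtGoodOrdSurjectiveTwo)
    (hDD : DokchitserDokchitser2012_surjective_mod_two_four_eight)
    (hlift : hasSurjectiveModNGaloisRep_two_pow_of_eight)
    (hEC : O1.TwoAdicEulerCharRankZero W 0) (hmod : nonempty_modularParametrizationData)
    (hGZK : rank_eq_analyticRank_of_analyticRank_le_one)
    (h17 : ∀ [NeZero (W.conductorNorm ℤ)] (f : CuspForm (Gamma0 (W.conductorNorm ℤ)) 2),
      kato_divisibility_allPrimes W 2 (f := f))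
    (hr : W.analyticRank = 0) (hgo : GoodOrd W 2)
    (h2 : ∀ P : W.toAffine.Point, 2 • P = 0 → P = 0) (hΔ : W.Δ < 0)
    (hΔ₁ : ¬ IsSquare (-W.Δ)) (hΔ₂ : ¬ IsSquare (2 * W.Δ)) (hΔ₃ : ¬ IsSquare (-2 * W.Δ))
    (hj : ∀ t : ℚ, W.j ≠ -4 * t ^ 3 * (t + 8)) (hlow : MissingLowerBoundAt W 2) : BSDp W 2 :=
  bsdp_two_of_katoReserveWK2_of_Δ_neg_of_missingLowerBoundAt W h hEC hmod hGZK h17 hr hgo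
    (O1.twoAdicSurjective_of_dokchitser W hDD hlift h2
      (fun hsq => by obtain ⟨r, hr'⟩ := hsq; nlinarith [hΔ, hr', mul_self_nonneg r]) hΔ₁ hΔ₂ hΔ₃ hj)
    hΔ hlow

/-- **Any-sign door, habitat from Dokchitser–Dokchitser data.**
[cite: DokchitserDokchitserMathZ2012, Theorem (p. 961)] [cite: Miller2011LMS, Def. 1.1 and §1] -/
theorem bsdp_two_of_katoReserveWK2_of_dokchitser_of_facts (h : KatoReserveWK2AtGoodOrdSurjectiveTwo)
    (hDD : DokchitserDokchitser2012_surjective_mod_two_four_eight)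
    (hlift : hasSurjectiveModNGaloisRep_two_pow_of_eight)
    (hAU : abbesUllmo_not_dvd_maninConstant_of_not_dvd_level)
    (hCT : exists_casselsTate_pairing (K := ℚ))
    (hGr : Greenberg1999.thm41_charValue_rankZero_anyPrime)
    (hmod : nonempty_modularParametrizationData)
    (hGZK : rank_eq_analyticRank_of_analyticRank_le_one)
    (h17 : ∀ [NeZero (W.conductorNorm ℤ)] (f : CuspForm (Gamma0 (W.conductorNorm ℤ)) 2),
      kato_divisibility_allPrimes W 2 (f := f))
    (hcm : ¬ W.HasCM) (hr : W.analyticRank = 0) (hgo : GoodOrd W 2)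
    (h2 : ∀ P : W.toAffine.Point, 2 • P = 0 → P = 0) (hΔ : ¬ IsSquare W.Δ)
    (hΔ₁ : ¬ IsSquare (-W.Δ)) (hΔ₂ : ¬ IsSquare (2 * W.Δ)) (hΔ₃ : ¬ IsSquare (-2 * W.Δ))
    (hj : ∀ t : ℚ, W.j ≠ -4 * t ^ 3 * (t + 8))
    (heven : O1.ShaAnTwoAdicValEven W) (hlow : MissingLowerBoundAt W 2) : BSDp W 2 :=
  bsdp_two_of_katoReserveWK2_of_facts W h hAU hCT hGr hmod hGZK h17 hcm hr hgo
    (O1.twoAdicSurjective_of_dokchitser W hDD hlift h2 hΔ hΔ₁ hΔ₂ hΔ₃ hj) heven hlow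

end Summit.BirchSwinnertonDyer.BirchSwinnertonDyer.Theorems.OrdKatoIntAtTwo

end
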